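/-
Copyright (c) 2026. All rights reserved.
Released under Apache 2.0 license as described in the file LICENSE.
-/
import Literature.AlgebraicGeometry.ComplexMultiplication.HyperellipticJacobianExceptionalClasses
import HarnessLib

/-!
# `MT(J_{p^k}) → MT(X_{p^k})` is an ISOMORPHISM, not merely an isogeny (Gallese–Goodson–Lombardo 2024, §7.2):
# the character lattice of the Jacobian family of an odd prime power is carried by its top factor

Layer `Literature/AlgebraicGeometry/ComplexMultiplication`, namespace `…ComplexMultiplication.HyperellipticJacobian` (shared with
`HyperellipticJacobianExceptionalClasses`, whose §6 `cmFamilyRank_eq_cmTypeRank_of_isPrimePow` is the ISOGENY (rank) form of the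
same statement: `rank MT(J_{p^e}) = rank MT(X_{p^e}) = φ(p^e)/2 + 1`, and whose honest column records «Conjectures 5.9/5.11 assert
ISOMORPHISMS — the index of the character lattices … is not typed»).  THIS FILE types the ISOMORPHISM, i.e. the INTEGRAL statement,
definition-free, on the two lattices that the tree's rank already uses: the indicator vectors `v_τ = translateInd Σ τ ∈ ℚ^{⊔_i Hom(K_i,ℂ)}`
of the `Aut(ℂ)`-translates of Deligne's total type `Σ = ⊔_i Φ_i` (`CMAlgebra.familyType`; their `ℚ`-span has dimension
`cmFamilyRank` = `dim MT(∏_i A_i)`, Deligne I Ex. 3.7 (c): they are the Galois conjugates of the cocharacter `μ`, spanning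
`X_*(MT) ⊗ ℚ`), their top components `w_τ = translateInd Φ_{top} τ`, and, dually, the integral characters `f : ⊔_i Hom(K_i, ℂ) → ℤ`
paired against them (`X^*(∏_i T_{K_i}) = ℤ[⊔_i Hom(K_i, ℂ)]`; the `f` with `⟨f, v_τ⟩ = 0` for all `τ` are the EQUATIONS of the
Mumford–Tate group, GGL §4.2).  THEOREMS ONLY (no definition, no named fact, no `sorry`, no instance).

## The print

A. Gallese, H. Goodson, D. Lombardo, *Monodromy groups and exceptional Hodge classes, I: Fermat Jacobians* (arXiv:2405.20394, 2024)
[GalleseGoodsonLombardo2024] (held text `paper:arxiv-2405.20394`, read first-hand: §1 p0005, §4.1–4.2 p0017–p0018, §7.2 p0033–p0037):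

* §1 «Results in families», PROPOSITION (MTprojection): «Let `p` be an odd prime number, `k` be a positive integer, and let `X_{p^k}`
  be the largest simple factor of `J_{p^k}`. The projection `J_{p^k} → X_{p^k}` induces an isomorphism `MT(J_{p^k}) → MT(X_{p^k})`
  between the corresponding Mumford–Tate groups.»  «Moreover, for `m = 15`, the simple factors of `J_{15}` are all nondegenerate
  but the projection of the Mumford–Tate group is an isogeny, not an isomorphism (see [Heidi]).»
* §4.1, Prop. 19 ([MR4557876] = D. Lombardo, Trans. AMS 376 (2023)): for `A = ∏_i A_i`, `A_i` of CM type `(E_i, Φ_i)`, `E_i/ℚ`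
  Galois, `L` their compositum, «The image of the map `T_L →(N) ∏_i T_{E_i} →(φ_i) ∏_i T_{E_i} ⊆ GL_V` is `MT(A)`» (norm, then the
  reflex norms «`φ_i^* : T̂_{E_i} → T̂_{E_i^*}, [φ] ↦ Σ_{σ ∈ Φ_i^*} [σφ]`»); §4.2: «Passing to character groups, we get a map
  `𝔈 : ⊕_i ℤx_i → ∏_d T̂_{E_d} →(φ_d^*) ∏_d T̂_{E_d} →(N^*) T̂_K`, the kernel of which is the character group of the torus corresponding
  to (base change of) the Mumford–Tate group»; Def. 21 (an EQUATION for `MT(J_m)` = a character trivial on it).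
* §7.2, proof of the Proposition (by induction on `k` through `MT(X_{p^k} × X_{p^{k−1}}) ≅ MT(X_{p^k})`): «the projection
  `MT(X_{p^k} × X_{p^{k−1}}) → MT(X_{p^k})` is an isomorphism if and only if `T̂_{E_1} × {0} + ker(N_1^*φ_1^* + N_2^*φ_2^*) =
  T̂_{E_1} × T̂_{E_2}` … Equivalently, for every `v ∈ T̂_{E_2}` there should exist `u ∈ T̂_{E_1}` such that `φ_1^*(u) = −N_2^*φ_2^*(v)`
  … every vector in the image of `N_2^*φ_2^*` is also in the image of `φ_1^*`»; the interval decomposition (pkinterval)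
  `[[1,(p^k−1)/2]] = [[1, p^{k−1}(p−1)/2]] ∪ [[p^{k−1}(p−1)/2 + 1, p^{k−1}(p−1)/2 + (p^{k−1}−1)/2]]`, «we obtain `(p−1)/2` copies of the
  interval `[[1, p^{k−1}]]` … the rightmost interval … `[[1, (p^{k−1}−1)/2]]` … give us the CM type of `X_{p^{k−1}}`»;
  LEMMA 60: «For every `τ` in `Hom(ℚ(ζ_{p^{k−1}}), ℚ̄)` we have `Σ_{σ|τ} φ_1^*[σ] = (p−1)/2 (Σ_σ [σ]) + N_2^*φ_2^*[τ]`»; end of proof: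
  «The first sum … can be written as `φ_1^*[σ_1] + φ_1^*[σ_{−1}]`. Thus … we have written `N_2^*φ_2^*[τ]` as a linear combination of
  elements in the image of `φ_1^*`»; after the proof: «the projection `π : MT(J_{p^k}) → MT(X_{p^k})`, `diag(x_1,…,x_{2g}) ↦ diag(x_i)_{(i,p)=1}`
  … is an isomorphism. Denote by `ψ` its inverse … `ψ_a := x_a ∘ ψ` is a character of `MT(X_{p^k})`, hence a Laurent monomial in the
  variables `x_i` with `(i,p) = 1` … the coordinates `x_i` with `p ∣ i` can be expressed as rational functions in the others.»
* §7.2, THEOREM 62 (`m = p^k`, `k > 1`): «(1) For every integer `1 ≤ a ≤ m−1` divisible by `p` and any choice of sets `B, C` as above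
  [a partition of the `p` indices `{a' + j·p^{k−1}}`, `p·(a' + jp^{k−1}) ≡ a`, with `|B| = |C| − 1 = (p−1)/2`], the expression
  `f_a : x_a · ∏_{b∈B} x_{p^k−b} / ∏_{c∈C} x_c` is an equation for `MT(J_m)`. (2) A set of equations defining `MT(J_m)` is given by the
  disjoint union of a set of defining equations for `MT(X_m)` and a single equation `f_a` … for every … `a` divisible by `p`.
  (3) The connected monodromy field `ℚ(ε_{J_m})` is … `ℚ(ζ_m)`.»
* H. Goodson [Goodson2024DegeneracyFermat] §5.3: Props. 5.8 / 5.10 (the projection is an isomorphism for `m = p²`, `p ≤ 29`, and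
  `m = p³`, `p ≤ 13`, by a Sage computation of a lattice index), Conjectures 5.9 / 5.11 (all `p`) — «this confirms and extends
  Conjecture 5.9 of [Heidi]» (GGL §1); Prop. 5.4 (`m = 15`: an isogeny of degree `2`).

## Dictionary (how the tori statements are read on the tree's carriers)

The tree has no Mumford–Tate torus of `∏_i A_i`; as in all files of this lane the statements are made on Deligne's index set
`S = ⊔_i Hom(K_i, ℂ)` (`K_i ≅ ℚ(ζ_{d_i})` via `IsCyclotomicExtension {d_i} ℚ (K_i)`, an embedding `x` read on its exponent
`e(x) ∈ (ℤ/d_i)ˣ`, `Aut(ℂ)` acting through the cyclotomic characters `u_{d}(τ)`, compatible under reduction — `Pohlmann1968.Cyclotomic`).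
`∏_i T_{K_i}` has character group `ℤ[S]` and cocharacter group `ℤ^S`; by Prop. 19 / Ex. 3.7 (c), `MT(∏_i A_i) ⊆ ∏_i T_{K_i}` is the
subtorus whose rational cocharacter space is `span_ℚ{v_τ : τ ∈ Aut(ℂ)}`, `v_τ(z) = [τ ∘ z ∈ Σ]` (`translateInd (familyType Φ) τ`;
`Aut(ℂ)` in place of `Gal(L/ℚ)`: same translates), whose cocharacter LATTICE is the set of integral points of that span, and whose
character group is `ℤ[S] / {f : ⟨f, v_τ⟩ = 0 ∀τ}` (the quotient by the EQUATIONS, §4.2).  The projection to the top factor `i₀` is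
`z = (i₀, x) ↦ x` on `S ⊇ Hom(K_{i₀}, ℂ)`, restriction `f ↦ f|_{top}` on `ℚ^S`, extension by zero `ℤ[Hom(K_{i₀},ℂ)] → ℤ[S]` on characters.
«The projection `MT(∏A_i) → MT(A_{i₀})` is an ISOMORPHISM» has then the three equivalent lattice readings typed below: (cochar) every
`v_τ` is the image of `w_τ` under ONE integer matrix; (char) `ℤ[Hom(K_{i₀},ℂ)] + {equations} = ℤ[S]`; (sat) a vector of `span_ℚ{v_τ}` is
integral iff its top component is (plus injectivity = the rank statement).  None of this needs a choice of inclusions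
`ℚ(ζ_{d_i}) ⊂ ℚ(ζ_{d₀})`: the fibre of an embedding `y` of `ℚ(ζ_{d₁})` is `{x : e(x) ≡ e(y) (mod d₁)}` (`ZMod.castHom`), which is the
fibre of the restriction along the inclusion `ζ_{d₁} ↦ ζ_{d₀}^{d₀/d₁}` coming from `C_{d₀} → C_{d₁}`, `(x,y) ↦ (x^{d₀/d₁}, y)` (§3.1).

## What is proved (`Φ_i` the lower-half types: `σ ∈ Φ_i ⟺ 2⟨e(σ)⟩ < d_i`, hypothesis `hΦ`, = the tree's `cmTypeOfResidues
(fermatCMType d_i 1 1 (-2))` by `mem_hyperelliptic_iff_half`; levels `d_i ∣ d_{i₀}` with ODD quotients and THE SAME PRIME FACTORS —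
`levels_of_isPrimePow`: automatic for the levels `p, p², …, p^k` of `J_{p^k}`)

* §1 (residues) **`card_fibre_filter_half`** — LEMMA 60 on `ℤ/m → ℤ/n` (`n ∣ m`, `m/n` odd): the fibre of `b` has `m/n` elements
  (`card_fibre`), EXACTLY `(m/n − 1)/2 + [2⟨b⟩ < n]` of them in the lower half (the interval count (pkinterval); copies of the
  private coset lemmas of `HyperellipticJacobianExceptionalClasses` §1, whose witness weight `Δ(u)` is the same coset).
* §2 **`translateInd_familyType_eq_sum_fibre_sub`** — LEMMA 60: `[τ∘y ∈ Φ_{d₁}] = #{x ∈ Hom(ℚ(ζ_{d₀}),ℂ) : e(x) ≡ e(y), τ∘x ∈ Φ_{d₀}}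
  − (d₀/d₁ − 1)/2` for all `τ ∈ Aut(ℂ)`, `y ∈ Hom(ℚ(ζ_{d₁}), ℂ)` (`card_filter_fibre_eq`: `x ↦ u_{d₀}(τ)e(x)` is a bijection of the
  fibre of `y` onto the residue fibre of `u_{d₁}(τ)e(y)` — «the elements … relatively prime to `p` are in bijection with
  `(ℤ/p^{k−1})ˣ`», all residues above a unit being units; `card_fibre_embeddings`: the fibre has `d₀/d₁` embeddings;
  `translateInd_familyType_eq_ite`: the indicators on exponents).
* §3 **`translateInd_familyType_eq_top_combination`** (the constant as `(d₀/d₁−1)/2·(w_τ(x₀) + w_τ(x̄₀))`, «`φ_1^*[σ_1] + φ_1^*[σ_{−1}]`»);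
  **`exists_int_matrix_translateInd_familyType`** — (cochar) ONE INTEGER MATRIX `M` with `v_τ(z) = Σ_x M(z,x) w_τ(x)` for all `τ, z`
  (row `z` = GGL's Laurent monomial `ψ_z`); **`exists_top_character`** — (char) for every `f : S → ℤ` there is `g : Hom(K_{i₀},ℂ) → ℤ`
  with `⟨f, v_τ⟩ = ⟨g, w_τ⟩` for all `τ` («`T̂_{E_1} × {0} + ker = T̂_{E_1} × T̂_{E_2}`», `Im N_2^*φ_2^* ⊆ Im φ_1^*`);
  `apply_eq_sum_top_of_mem_span`, **`integral_of_top_integral`** — (sat) a vector of `span_ℚ{v_τ}` with integral top component is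
  integral; **`eq_zero_of_top_eq_zero`** — (inj) … with zero top component is zero; **`equation_fa`** — THEOREM 62 (1): for every
  lower `z` and every `B ⊆ fibre(z)` with `2|B| + 1 = d₀/d₁`, `v_τ(z) + Σ_{b∈B} w_τ(b̄) − Σ_{c ∈ fibre∖B} w_τ(c) = 0` for all `τ` — the
  character `δ_z + Σ_B δ_{b̄} − Σ_C δ_c` (`f_a = x_a ∏_B x_{p^k−b} / ∏_C x_c`) is an EQUATION of the family.
* §4 (the print's case `m = p^k`): `levels_of_isPrimePow`; **`exists_top_character_of_isPrimePow`**,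
  **`integral_of_top_integral_of_isPrimePow`**, `translateInd_familyType_eq_sum_fibre_sub_of_isPrimePow` — the Proposition for the CM
  data of `J_{p^k}` (levels `1 < d_i ∣ p^k`, one of them `p^k`; `p` odd), in character and cocharacter form, and Lemma 60 between any
  two of its levels.

## Honest column / NOT here

* As in the companions, `J_m`, the `X_d` and the projection of Mumford–Tate TORI are not constructed: the statements are the three
  lattice identities to which «`MT(J_{p^k}) → MT(X_{p^k})` is an isomorphism» is equivalent under Prop. 19 / Deligne I Ex. 3.7 (c)
  (`X_*(MT) ⊗ ℚ = span_ℚ{v_τ}`, quoted, not re-proved here; the tree's `cmFamilyRank` is defined by the same identification).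
* Thm. 62 (2) (the equations of `MT(X_m)` together with the `f_a` DEFINE `MT(J_m)`) is not typed as a generation statement; its two
  ingredients are `exists_top_character` (every character is congruent to a top character modulo equations) and `equation_fa`.
  Thm. 62 (3), Cor. (maincorollary), the `Γ`-values and everything on connected monodromy fields / Sato–Tate groups are outside the
  tree's vocabulary.  The one-step induction of the print is replaced by the direct fibre count between `p^k` and any `p^j`.
* The generality typed (levels dividing the top one with odd quotients and the same prime factors) is exactly what the fibre count
  uses; for `m = pq…` with distinct primes the fibres contain non-units and the identity fails — `m = 15`: «an isogeny, not an
  isomorphism» (Goodson Prop. 5.4: degree `2`), NOT typed here.  Nothing here is an algebraicity statement; `HC_CM` is not touched.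

## References

* [GalleseGoodsonLombardo2024] A. Gallese, H. Goodson, D. Lombardo, arXiv:2405.20394 (2024) — §1 Proposition (MTprojection);
  §3.1; §4.1 Prop. 19, §4.2 (Lemma 20, Def. 21, Cor. 22); §7.2 Lemma 60, Proposition (proof), Theorem 62 (1)–(2).
* D. Lombardo, *Non-isogenous abelian varieties sharing the same division fields*, Trans. Amer. Math. Soc. 376 (2023) 2615–2640
  [MR4557876] — the description of `MT(∏A_i)` and the projection criterion, quoted THROUGH GGL §4.1 / §7.2 (not held).
* [Goodson2024DegeneracyFermat] H. Goodson, Exp. Math. 34 (2024) — §5.3 Props. 5.4, 5.8, 5.10, Conjectures 5.9, 5.11.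
* [Deligne1982HodgeCycles] P. Deligne, LNM 900 — I Ex. 3.7 (c).  [Dodson1987] — §1.1.  [Washington1997] — Thm. 2.5.

## Provenance

Cell `pub-hodgecm2` (COR-CM), KEPT Literature lane `lit-deligne-3` gen 50 (claim GGL24-PRIMEPOWER-MT-ISOMORPHISM; count-neutral,
own lane); g49 DELIVERABLE §5 outlook item 1.
-/

noncomputable section

open NumberField

namespace Literature.AlgebraicGeometry.ComplexMultiplication

namespace HyperellipticJacobian

/-! ## §1 Residues: the fibres of `ℤ/m → ℤ/n` and their lower halves (Lemma 60 on residues) -/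

section Fibre

variable {n q : ℕ}

/-- `a₀ + jn < nq` for `a₀ < n`, `j < q`. [folklore] -/
private theorem lt_nq {a₀ j : ℕ} (ha : a₀ < n) (hj : j < q) : a₀ + j * n < n * q := by
  have h1 : j * n + n ≤ q * n := by
    have h := Nat.mul_le_mul_right n (Nat.succ_le_of_lt hj)
    rwa [Nat.succ_mul] at h
  rw [Nat.mul_comm n q]
  omega

/-- The residue `a₀ + jn` of `ℤ/(nq)` has representative `a₀ + jn` (`a₀ < n`, `j < q`). [folklore] -/
private theorem val_fibre_elt {a₀ j : ℕ} (ha : a₀ < n) (hj : j < q) :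
    ((a₀ + j * n : ℕ) : ZMod (n * q)).val = a₀ + j * n :=
  ZMod.val_natCast_of_lt (lt_nq ha hj)

/-- `j ↦ a₀ + jn` is injective on `j < q` as a map to `ℤ/(nq)` (`a₀ < n`). [folklore] -/
private theorem fibre_elt_injOn [NeZero n] {a₀ : ℕ} (ha : a₀ < n) :
    Set.InjOn (fun j => ((a₀ + j * n : ℕ) : ZMod (n * q))) (Finset.range q : Set ℕ) := by
  intro j hj j' hj' h
  have hv := congrArg ZMod.val h
  simp only at hv
  rw [val_fibre_elt ha (Finset.mem_range.1 hj), val_fibre_elt ha (Finset.mem_range.1 hj')] at hv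
  exact Nat.eq_of_mul_eq_mul_right (Nat.pos_of_ne_zero (NeZero.ne n)) (by omega)

/-- **The fibre `{t ∈ ℤ/(nq) : t ≡ a₀ (mod n)}` is `{a₀ + jn : j < q}`** (`a₀ < n`) — the «intervals»
`[[1, p^{k−1}]] ∪ [[p^{k−1}+1, 2p^{k−1}]] ∪ ⋯` of the proof of the Proposition, reduced modulo `p^{k−1}`
(copy of the private helper `coset_eq_image` of `HyperellipticJacobianExceptionalClasses`).
[cite: GalleseGoodsonLombardo2024, §7.2 (proof of the Proposition, eq. (pkinterval))] -/
private theorem fibre_eq_image [NeZero n] [NeZero q] {a₀ : ℕ} (ha : a₀ < n) :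
    (Finset.univ.filter fun t : ZMod (n * q) => ZMod.castHom (Dvd.intro q rfl) (ZMod n) t = (a₀ : ZMod n)) =
      (Finset.range q).image fun j => ((a₀ + j * n : ℕ) : ZMod (n * q)) := by
  ext t
  simp only [Finset.mem_filter, Finset.mem_univ, true_and, Finset.mem_image, Finset.mem_range]
  constructor
  · intro ht
    rw [ZMod.castHom_apply, ZMod.cast_eq_val, ZMod.natCast_eq_natCast_iff', Nat.mod_eq_of_lt ha] at ht
    have hlt := ZMod.val_lt t
    refine ⟨t.val / n, (Nat.div_lt_iff_lt_mul (Nat.pos_of_ne_zero (NeZero.ne n))).2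
      (by rw [Nat.mul_comm q n]; exact hlt), ?_⟩
    have hdecomp : a₀ + t.val / n * n = t.val := by
      have := Nat.mod_add_div t.val n
      rw [ht] at this
      linarith [Nat.mul_comm n (t.val / n)]
    rw [hdecomp, ZMod.natCast_zmod_val]
  · rintro ⟨j, -, rfl⟩
    rw [map_natCast]
    push_cast
    rw [ZMod.natCast_self, mul_zero, add_zero]

/-- The fibre has `q` elements. [folklore] -/
private theorem card_fibre_residues [NeZero n] [NeZero q] {a₀ : ℕ} (ha : a₀ < n) :
    (Finset.univ.filter fun t : ZMod (n * q) =>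
      ZMod.castHom (Dvd.intro q rfl) (ZMod n) t = (a₀ : ZMod n)).card = q := by
  rw [fibre_eq_image ha, Finset.card_image_of_injOn (fibre_elt_injOn ha), Finset.card_range]

/-- **The half count on a fibre**: for `q` odd and `a₀ < n`, `#{j < q : 2(a₀ + jn) < nq} = (q−1)/2 + [2a₀ < n]` — the
first `(q−1)/2` values of `j` always qualify, `j = (q−1)/2` qualifies iff `2a₀ < n`, larger `j` never do («we obtain
`(p−1)/2` copies of the interval `[[1,p^{k−1}]]` … the rightmost interval … `[[1,(p^{k−1}−1)/2]]`»; copy of the private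
helper `card_filter_range_half` of `HyperellipticJacobianExceptionalClasses`).
[cite: GalleseGoodsonLombardo2024, §7.2 (proof of the Proposition, eq. (pkinterval))] -/
private theorem card_filter_range_half' (hq : Odd q) {a₀ : ℕ} (ha : a₀ < n) :
    ((Finset.range q).filter fun j => 2 * (a₀ + j * n) < n * q).card =
      (q - 1) / 2 + if 2 * a₀ < n then 1 else 0 := by
  obtain ⟨r, rfl⟩ := hq
  have hr : (2 * r + 1 - 1) / 2 = r := by omega
  rw [hr]
  have e1 : n * (2 * r + 1) = 2 * (r * n) + n := by ring
  suffices h : ((Finset.range (2 * r + 1)).filter fun j => 2 * (a₀ + j * n) < n * (2 * r + 1)) =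
      Finset.range (r + if 2 * a₀ < n then 1 else 0) by
    rw [h, Finset.card_range]
  ext j
  simp only [Finset.mem_filter, Finset.mem_range]
  by_cases h2 : 2 * a₀ < n
  · rw [if_pos h2]
    constructor
    · rintro ⟨-, hj⟩
      by_contra hcon
      have hle : (r + 1) * n ≤ j * n := Nat.mul_le_mul_right n (by omega)
      have e2 : (r + 1) * n = r * n + n := by ring
      omega
    · intro hj
      have hle : j * n ≤ r * n := Nat.mul_le_mul_right n (by omega)
      constructor <;> omega
  · rw [if_neg h2, add_zero]
    constructor
    · rintro ⟨-, hj⟩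
      by_contra hcon
      have hle : r * n ≤ j * n := Nat.mul_le_mul_right n (by omega)
      omega
    · intro hj
      have hle : (j + 1) * n ≤ r * n := Nat.mul_le_mul_right n (by omega)
      have e3 : (j + 1) * n = j * n + n := by ring
      constructor <;> omega

/-- The half count on the fibre of `a₀` in `ℤ/(nq)`: `(q−1)/2 + [2a₀ < n]` (`q` odd). [folklore] -/
private theorem card_fibre_filter_half_residues [NeZero n] [NeZero q] (hq : Odd q) {a₀ : ℕ} (ha : a₀ < n) :
    (Finset.univ.filter fun t : ZMod (n * q) =>
        ZMod.castHom (Dvd.intro q rfl) (ZMod n) t = (a₀ : ZMod n) ∧ 2 * t.val < n * q).card =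
      (q - 1) / 2 + if 2 * a₀ < n then 1 else 0 := by
  rw [← Finset.filter_filter, fibre_eq_image ha, Finset.filter_image,
    Finset.card_image_of_injOn (fun j hj j' hj' h =>
      fibre_elt_injOn ha (Finset.mem_of_mem_filter j hj) (Finset.mem_of_mem_filter j' hj') h),
    ← card_filter_range_half' hq ha]
  congr 1
  refine Finset.filter_congr fun j hj => ?_
  rw [val_fibre_elt ha (Finset.mem_range.1 hj)]

/-- **LEMMA 60 ON RESIDUES.**  For `n ∣ m` with `m/n = q` ODD and a residue `b ∈ ℤ/n`, the fibre of `b` under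
`ℤ/m → ℤ/n` has `q` elements, of which EXACTLY `(q − 1)/2 + [2⟨b⟩ < n]` lie in the lower half `{t : 2⟨t⟩ < m}` — the
count behind «if we now take the reduction modulo `p^{k−1}` of the values in these intervals, we obtain `(p−1)/2` copies
of the interval `[[1, p^{k−1}]]` … the rightmost interval … `[[1, (p^{k−1}−1)/2]]` … give us the CM type of `X_{p^{k−1}}`»
(there `m = p^k`, `n = p^{k−1}`, `q = p`).  [cite: GalleseGoodsonLombardo2024, §7.2 Lemma 60 (proof) and eq. (pkinterval)] -/
theorem card_fibre_filter_half {m n : ℕ} [NeZero m] [NeZero n] (hnm : n ∣ m) (hq : Odd (m / n)) (b : ZMod n) :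
    (Finset.univ.filter fun t : ZMod m => ZMod.castHom hnm (ZMod n) t = b ∧ 2 * t.val < m).card =
      (m / n - 1) / 2 + if 2 * b.val < n then 1 else 0 := by
  obtain ⟨q, rfl⟩ := hnm
  have hn : 0 < n := Nat.pos_of_ne_zero (NeZero.ne n)
  haveI : NeZero q := ⟨fun h => NeZero.ne (n * q) (by rw [h, mul_zero])⟩
  rw [Nat.mul_div_cancel_left q hn] at hq ⊢
  have hb : b = ((b.val : ℕ) : ZMod n) := (ZMod.natCast_zmod_val b).symm
  conv_lhs => rw [hb]
  exact card_fibre_filter_half_residues hq (ZMod.val_lt b)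

/-- The fibre of `b` under `ℤ/m → ℤ/n` has `m/n` elements («the first (double) sum gives all residues modulo `p^k` exactly once»).
[cite: GalleseGoodsonLombardo2024, §7.2 Lemma 60 (proof)] -/
theorem card_fibre {m n : ℕ} [NeZero m] [NeZero n] (hnm : n ∣ m) (b : ZMod n) :
    (Finset.univ.filter fun t : ZMod m => ZMod.castHom hnm (ZMod n) t = b).card = m / n := by
  obtain ⟨q, rfl⟩ := hnm
  have hn : 0 < n := Nat.pos_of_ne_zero (NeZero.ne n)
  haveI : NeZero q := ⟨fun h => NeZero.ne (n * q) (by rw [h, mul_zero])⟩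
  rw [Nat.mul_div_cancel_left q hn]
  have hb : b = ((b.val : ℕ) : ZMod n) := (ZMod.natCast_zmod_val b).symm
  conv_lhs => rw [hb]
  exact card_fibre_residues (ZMod.val_lt b)

end Fibre

/-! ## §2 LEMMA 60: the translate indicators of a lower factor are carried by the top factor -/

section Lemma60

open Literature.NumberTheory.ComplexMultiplication
open Literature.AlgebraicGeometry.Motives (CMType)
open Literature.AlgebraicGeometry.Pohlmann1968 Literature.AlgebraicGeometry.Pohlmann1968.Cyclotomic
open Literature.AlgebraicGeometry.Pohlmann1968.CMAlgebra
open scoped Literature.NumberTheory.ComplexMultiplication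

variable {k : ℕ} {lev : Fin k → ℕ} [∀ i, NeZero (lev i)] {K : Fin k → Type} [∀ i, Field (K i)]
  [∀ i, NumberField (K i)] [∀ i, IsCyclotomicExtension {lev i} ℚ (K i)] {Φ : ∀ i, CMType (K i)}

/-- **The translate indicators read on exponents**: for hyperelliptic (lower-half) types, `[τ ∘ σ ∈ Φ_i] = [2⟨u_{d_i}(τ)·e(σ)⟩ < d_i]`
(the cyclotomic character `u(τ)` acts on the exponents, `expOf_comp`). [cite: GalleseGoodsonLombardo2024, §3 Lemma 11 (the CM type `Φ_m = {σ_j : j ≤ g(m)}`)] -/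
theorem translateInd_familyType_eq_ite (hΦ : ∀ i (σ : K i →+* ℂ), σ ∈ (Φ i).1 ↔ 2 * (expOf (lev i) (K i) σ).val < lev i)
    (τ : ℂ ≃+* ℂ) (z : (i : Fin k) × (K i →+* ℂ)) :
    translateInd (familyType Φ) τ z =
      if 2 * (autExp (lev z.1) τ * expOf (lev z.1) (K z.1) z.2).val < lev z.1 then 1 else 0 := by
  have key : τ • z ∈ familyType Φ ↔ 2 * (autExp (lev z.1) τ * expOf (lev z.1) (K z.1) z.2).val < lev z.1 := by
    rw [CMAlgebra.smul_mem_familyType_iff, hΦ, expOf_comp]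
  by_cases h : 2 * (autExp (lev z.1) τ * expOf (lev z.1) (K z.1) z.2).val < lev z.1
  · rw [if_pos h, translateInd_of_mem (key.2 h)]
  · rw [if_neg h, translateInd_of_not_mem (fun h' => h (key.1 h'))]

/-- A residue of `ℤ/N` prime to `N` is a unit. [folklore] -/
private theorem isUnit_of_val_coprime {N : ℕ} [NeZero N] {t : ZMod N} (ht : t.val.Coprime N) : IsUnit t := by
  rw [← ZMod.natCast_zmod_val t]
  exact (ZMod.isUnit_iff_coprime t.val N).2 ht

/-- `⟨cast t⟩ = ⟨t⟩ mod n` for the reduction `ℤ/m → ℤ/n`. [folklore] -/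
private theorem val_castHom {m n : ℕ} [NeZero m] [NeZero n] (hnm : n ∣ m) (t : ZMod m) :
    (ZMod.castHom hnm (ZMod n) t).val = t.val % n := by
  rw [ZMod.castHom_apply, ZMod.cast_eq_val, ZMod.val_natCast]

/-- A residue of `ℤ/m` whose reduction modulo `n` is prime to `n` is prime to `n`. [folklore] -/
private theorem coprime_val_of_castHom {m n : ℕ} [NeZero m] [NeZero n] (hnm : n ∣ m) {t : ZMod m}
    (ht : (ZMod.castHom hnm (ZMod n) t).val.Coprime n) : t.val.Coprime n := by
  rw [val_castHom] at ht
  rw [Nat.Coprime, Nat.gcd_comm, Nat.gcd_rec]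
  exact ht

/-- **The fibre of an embedding.**  For levels `d₁ ∣ d₀` such that every integer prime to `d₁` is prime to `d₀` (the same
prime factors: a prime-power tower), a unit `c ∈ ℤ/d₀` and an embedding `y` of `ℚ(ζ_{d₁})`: `x ↦ c·e(x)` is a bijection from
the embeddings `x` of `ℚ(ζ_{d₀})` with `e(x) ≡ e(y) (mod d₁)` onto the residues `t ∈ ℤ/d₀` with `t ≡ c̄·e(y) (mod d₁)` — ALL of
which are units («The elements of this interval that are relatively prime to `p` are in bijection with `(ℤ/p^{k−1}ℤ)ˣ`»);
counted through any predicate `P`. [cite: GalleseGoodsonLombardo2024, §7.2 (proof of the Proposition)] -/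
theorem card_filter_fibre_eq {i₀ i₁ : Fin k} (hdvd : lev i₁ ∣ lev i₀)
    (hrad : ∀ a : ℕ, a.Coprime (lev i₁) → a.Coprime (lev i₀)) {c : ZMod (lev i₀)} (hc : IsUnit c)
    (y : K i₁ →+* ℂ) (P : ZMod (lev i₀) → Prop) [DecidablePred P] :
    (Finset.univ.filter fun x : K i₀ →+* ℂ =>
        ZMod.castHom hdvd (ZMod (lev i₁)) (expOf (lev i₀) (K i₀) x) = expOf (lev i₁) (K i₁) y ∧
          P (c * expOf (lev i₀) (K i₀) x)).card =
      (Finset.univ.filter fun t : ZMod (lev i₀) =>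
        ZMod.castHom hdvd (ZMod (lev i₁)) t = ZMod.castHom hdvd (ZMod (lev i₁)) c * expOf (lev i₁) (K i₁) y ∧ P t).card := by
  classical
  obtain ⟨cu, hcu⟩ := hc
  refine Finset.card_bij (fun x _ => c * expOf (lev i₀) (K i₀) x) (fun x hx => ?_) (fun x hx x' hx' h => ?_)
    (fun t ht => ?_)
  · obtain ⟨h1, h2⟩ := (Finset.mem_filter.1 hx).2
    exact Finset.mem_filter.2 ⟨Finset.mem_univ _, by rw [map_mul, h1], h2⟩
  · rw [← hcu] at h
    exact expOf_injective (lev i₀) (K i₀) (by simpa using h)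
  · obtain ⟨h1, h2⟩ := (Finset.mem_filter.1 ht).2
    -- `s = c⁻¹ t` reduces to `e(y)`, a unit modulo `d₁`, hence is a unit modulo `d₀`: an exponent `e(x)`
    set s : ZMod (lev i₀) := (↑cu⁻¹ : ZMod (lev i₀)) * t with hs
    have hcs : c * s = t := by rw [hs, ← hcu, ← mul_assoc, Units.mul_inv, one_mul]
    have hcast : ZMod.castHom hdvd (ZMod (lev i₁)) s = expOf (lev i₁) (K i₁) y := by
      have hcast_c : IsUnit (ZMod.castHom hdvd (ZMod (lev i₁)) c) := by rw [← hcu]; exact (cu.map _).isUnit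
      have := congrArg (ZMod.castHom hdvd (ZMod (lev i₁))) hcs
      rw [map_mul, h1] at this
      exact hcast_c.mul_left_cancel this
    have hcop : s.val.Coprime (lev i₀) :=
      hrad _ (coprime_val_of_castHom hdvd (by rw [hcast]; exact coprime_expOf (lev i₁) (K i₁) y))
    obtain ⟨x, hx⟩ := exists_expOf_eq (lev i₀) (K i₀) s hcop
    refine ⟨x, Finset.mem_filter.2 ⟨Finset.mem_univ _, by rw [hx, hcast], by rw [hx, hcs]; exact h2⟩, by rw [hx, hcs]⟩

/-- **The fibre of an embedding of `ℚ(ζ_{d₁})` in `Hom(ℚ(ζ_{d₀}), ℂ)` has `d₀/d₁` elements** (same prime factors).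
[cite: GalleseGoodsonLombardo2024, §7.2 (proof of the Proposition)] -/
theorem card_fibre_embeddings {i₀ i₁ : Fin k} (hdvd : lev i₁ ∣ lev i₀)
    (hrad : ∀ a : ℕ, a.Coprime (lev i₁) → a.Coprime (lev i₀)) (y : K i₁ →+* ℂ) :
    (Finset.univ.filter fun x : K i₀ →+* ℂ =>
        ZMod.castHom hdvd (ZMod (lev i₁)) (expOf (lev i₀) (K i₀) x) = expOf (lev i₁) (K i₁) y).card =
      lev i₀ / lev i₁ := by
  classical
  have h := card_filter_fibre_eq hdvd hrad (c := 1) isUnit_one y (fun _ => True)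
  simp only [one_mul, map_one, and_true] at h
  rw [h, card_fibre]

/-- **LEMMA 60 (Gallese–Goodson–Lombardo), for every pair of levels `d₁ ∣ d₀` with the same prime factors and `d₀/d₁` odd**
(the printed case: `d₀ = p^k`, `d₁ = p^{k−1}`): for every `τ ∈ Aut(ℂ)` and every embedding `y` of `ℚ(ζ_{d₁})`,
`[τ ∘ y ∈ Φ_{d₁}] = #{x ∈ Hom(ℚ(ζ_{d₀}), ℂ) : e(x) ≡ e(y) (mod d₁), τ ∘ x ∈ Φ_{d₀}} − (d₀/d₁ − 1)/2` — the translate indicator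
of the LOWER factor is an INTEGRAL linear combination of the translate indicators of the top factor.  Printed on characters:
«`Σ_{σ|τ} φ_1^*[σ] = (p−1)/2 (Σ_σ [σ]) + N_2^*φ_2^*[τ]`»; here on Deligne's cocharacter side (the indicator vectors of the
translates of `Σ = ⊔_i Φ_i`, whose span is `X_*(MT)`), which is the same identity read at each `τ`.
[cite: GalleseGoodsonLombardo2024, §7.2 Lemma 60] -/
theorem translateInd_familyType_eq_sum_fibre_sub {i₀ i₁ : Fin k} (hdvd : lev i₁ ∣ lev i₀) (hodd : Odd (lev i₀ / lev i₁))
    (hrad : ∀ a : ℕ, a.Coprime (lev i₁) → a.Coprime (lev i₀))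
    (hΦ : ∀ i (σ : K i →+* ℂ), σ ∈ (Φ i).1 ↔ 2 * (expOf (lev i) (K i) σ).val < lev i)
    (τ : ℂ ≃+* ℂ) (y : K i₁ →+* ℂ) :
    translateInd (familyType Φ) τ ⟨i₁, y⟩ =
      (∑ x ∈ Finset.univ.filter fun x : K i₀ →+* ℂ =>
          ZMod.castHom hdvd (ZMod (lev i₁)) (expOf (lev i₀) (K i₀) x) = expOf (lev i₁) (K i₁) y,
        translateInd (familyType Φ) τ ⟨i₀, x⟩) - ((lev i₀ / lev i₁ - 1) / 2 : ℕ) := by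
  classical
  simp only [translateInd_familyType_eq_ite hΦ]
  rw [Finset.sum_boole, Finset.filter_filter,
    card_filter_fibre_eq hdvd hrad (isUnit_of_val_coprime (coprime_autExp (lev i₀) τ)) y (fun t => 2 * t.val < lev i₀),
    castHom_autExp (lev i₁) (lev i₀) hdvd τ, card_fibre_filter_half hdvd hodd]
  push_cast
  split_ifs <;> ring

end Lemma60

/-! ## §3 THE PROPOSITION: the character lattice of the family is carried by the top factor -/

section Lattice

open Literature.NumberTheory.ComplexMultiplication
open Literature.AlgebraicGeometry.Motives (CMType)
open Literature.AlgebraicGeometry.Pohlmann1968 Literature.AlgebraicGeometry.Pohlmann1968.Cyclotomic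
open Literature.AlgebraicGeometry.Pohlmann1968.CMAlgebra
open scoped Literature.NumberTheory.ComplexMultiplication

variable {k : ℕ} {lev : Fin k → ℕ} [∀ i, NeZero (lev i)] {K : Fin k → Type} [∀ i, Field (K i)]
  [∀ i, NumberField (K i)] [∀ i, IsCyclotomicExtension {lev i} ℚ (K i)] {Φ : ∀ i, CMType (K i)} {i₀ : Fin k}

omit [∀ i, NeZero (lev i)] in
/-- `ℚ(ζ_d)`, `d > 2`, is a CM field (Mathlib). [folklore] -/
private theorem isCMField_top (h2 : 2 < lev i₀) : IsCMField (K i₀) :=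
  IsCyclotomicExtension.Rat.isCMField (K i₀) (S := {lev i₀}) ⟨lev i₀, rfl, h2⟩

omit [∀ i, NeZero (lev i)] in
/-- `[τ ∘ x̄₀ ∈ Φ] = 1 − [τ ∘ x₀ ∈ Φ]`: a translate of a CM type contains exactly one of `x₀, x̄₀` («the last sum can be written
as `φ_1^*[σ_1] + φ_1^*[σ_{−1}]`»). [cite: GalleseGoodsonLombardo2024, §7.2 (end of the proof of the Proposition)] -/
theorem translateInd_conjugate_eq_one_sub (h2 : 2 < lev i₀) (τ : ℂ ≃+* ℂ) (x₀ : K i₀ →+* ℂ) :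
    translateInd (Φ i₀).1 τ (ComplexEmbedding.conjugate x₀) = 1 - translateInd (Φ i₀).1 τ x₀ := by
  haveI := isCMField_top (K := K) h2
  rw [← conj_smul_eq_conjugate]
  exact (isCMTypeWith_conj (Φ i₀)).translateInd_rho_smul τ x₀

/-- **LEMMA 60 with the constant written as a character of the top factor**: for every base embedding `x₀` of the top field,
`[τ∘y ∈ Φ_{d₁}] = Σ_{x ≡ y} [τ∘x ∈ Φ_{d₀}] − (d₀/d₁ − 1)/2 · ([τ∘x₀ ∈ Φ_{d₀}] + [τ∘x̄₀ ∈ Φ_{d₀}])` — an INTEGRAL linear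
combination of the translate indicators of the top factor alone («the first sum … can be written as `φ_1^*[σ_1] + φ_1^*[σ_{−1}]`.
Thus … we have written `N_2^*φ_2^*[τ]` as a linear combination of elements in the image of `φ_1^*`»).
[cite: GalleseGoodsonLombardo2024, §7.2 Lemma 60 and the end of the proof of the Proposition] -/
theorem translateInd_familyType_eq_top_combination (hdvd : ∀ i, lev i ∣ lev i₀) (hodd : ∀ i, Odd (lev i₀ / lev i))
    (hrad : ∀ i (a : ℕ), a.Coprime (lev i) → a.Coprime (lev i₀)) (h2 : 2 < lev i₀)
    (hΦ : ∀ i (σ : K i →+* ℂ), σ ∈ (Φ i).1 ↔ 2 * (expOf (lev i) (K i) σ).val < lev i)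
    (x₀ : K i₀ →+* ℂ) (τ : ℂ ≃+* ℂ) (z : (i : Fin k) × (K i →+* ℂ)) :
    translateInd (familyType Φ) τ z =
      (∑ x ∈ Finset.univ.filter fun x : K i₀ →+* ℂ =>
          ZMod.castHom (hdvd z.1) (ZMod (lev z.1)) (expOf (lev i₀) (K i₀) x) = expOf (lev z.1) (K z.1) z.2,
        translateInd (Φ i₀).1 τ x) -
      ((lev i₀ / lev z.1 - 1) / 2 : ℕ) * (translateInd (Φ i₀).1 τ x₀ + translateInd (Φ i₀).1 τ (ComplexEmbedding.conjugate x₀)) := by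
  obtain ⟨i, y⟩ := z
  rw [translateInd_familyType_eq_sum_fibre_sub (hdvd i) (hodd i) (hrad i) hΦ τ y, translateInd_conjugate_eq_one_sub h2]
  simp only [CMAlgebra.translateInd_familyType]
  ring

/-- **THE PROPOSITION, COCHARACTER FORM.**  For the CM data of a Jacobian family all of whose levels divide the top level `d₀`
with odd quotients and the same prime factors (`J_{p^k}`: levels `p, p², …, p^k`), there is ONE INTEGER MATRIX
`M : ⊔_i Hom(ℚ(ζ_{d_i}), ℂ) × Hom(ℚ(ζ_{d₀}), ℂ) → ℤ` such that EVERY translate indicator of Deligne's `Σ = ⊔_i Φ_i` is the image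
of its top component: `v_τ(z) = Σ_x M(z, x)·w_τ(x)` for all `τ ∈ Aut(ℂ)` — the Galois conjugates of the cocharacter `μ` of
`∏_i A_i`, which span `X_*(MT(∏_i A_i))`, are obtained from those of the top factor by a fixed `ℤ`-linear map; on tori: the
projection `MT(J_{p^k}) → MT(X_{p^k})` is injective on cocharacter lattices AND on their saturations («the projection
`J_{p^k} → X_{p^k}` induces an isomorphism `MT(J_{p^k}) → MT(X_{p^k})`»; GGL's «`ψ_a := x_a ∘ ψ` is a character of `MT(X_{p^k})`,
hence a Laurent monomial in the variables `x_i` with `(i,p) = 1`» — row `z` of `M` is that monomial).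
[cite: GalleseGoodsonLombardo2024, §1 «Results in families» Proposition and §7.2 (proof)] -/
theorem exists_int_matrix_translateInd_familyType (hdvd : ∀ i, lev i ∣ lev i₀) (hodd : ∀ i, Odd (lev i₀ / lev i))
    (hrad : ∀ i (a : ℕ), a.Coprime (lev i) → a.Coprime (lev i₀)) (h2 : 2 < lev i₀)
    (hΦ : ∀ i (σ : K i →+* ℂ), σ ∈ (Φ i).1 ↔ 2 * (expOf (lev i) (K i) σ).val < lev i) :
    ∃ M : ((i : Fin k) × (K i →+* ℂ)) → (K i₀ →+* ℂ) → ℤ,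
      ∀ (τ : ℂ ≃+* ℂ) (z : (i : Fin k) × (K i →+* ℂ)),
        translateInd (familyType Φ) τ z = ∑ x, (M z x : ℚ) * translateInd (Φ i₀).1 τ x := by
  classical
  obtain ⟨x₀⟩ := (inferInstance : Nonempty (K i₀ →+* ℂ))
  refine ⟨fun z x =>
    (if ZMod.castHom (hdvd z.1) (ZMod (lev z.1)) (expOf (lev i₀) (K i₀) x) = expOf (lev z.1) (K z.1) z.2 then 1 else 0) -
      (if x = x₀ then (((lev i₀ / lev z.1 - 1) / 2 : ℕ) : ℤ) else 0) -
      (if x = ComplexEmbedding.conjugate x₀ then (((lev i₀ / lev z.1 - 1) / 2 : ℕ) : ℤ) else 0), fun τ z => ?_⟩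
  rw [translateInd_familyType_eq_top_combination hdvd hodd hrad h2 hΦ x₀ τ z, Finset.sum_filter]
  simp only [Int.cast_sub, Int.cast_ite, Int.cast_one, Int.cast_zero, Int.cast_natCast, sub_mul,
    Finset.sum_sub_distrib, ite_mul, one_mul, zero_mul, Finset.sum_ite_eq', Finset.mem_univ, if_true]
  ring

/-- **THE PROPOSITION, CHARACTER FORM (Lombardo's criterion, as used by Gallese–Goodson–Lombardo).**  Every integral character
of the family is represented on the top factor: for every `f : ⊔_i Hom(ℚ(ζ_{d_i}), ℂ) → ℤ` there is `g : Hom(ℚ(ζ_{d₀}), ℂ) → ℤ`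
with `⟨f, v_τ⟩ = ⟨g, w_τ⟩` for every `τ ∈ Aut(ℂ)` (`v_τ`, `w_τ` the translate indicators of `Σ` and of `Φ_{d₀}`).  Since the kernel
of `f ↦ (τ ↦ ⟨f, v_τ⟩)` is the lattice of EQUATIONS of the Mumford–Tate group («the kernel of [`𝔈`] is the character group of
the torus corresponding to the Mumford–Tate group», §4.2) this is «`T̂_{E_1} × {0} + ker(N_1^*φ_1^* + N_2^*φ_2^*) = T̂_{E_1} × T̂_{E_2}`»,
i.e. `X^*(MT(X_{p^k})) → X^*(MT(J_{p^k}))` is SURJECTIVE: **the projection `MT(J_{p^k}) → MT(X_{p^k})` is an ISOMORPHISM, not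
merely an isogeny** (the ranks agree: `HyperellipticJacobian.cmFamilyRank_eq_cmTypeRank_of_isPrimePow`).
[cite: GalleseGoodsonLombardo2024, §1 «Results in families» Proposition; §7.2 (proof, the criterion of [MR4557876] Lemma 60)]
[cite: GalleseGoodsonLombardo2024, §4.1 Prop. 19 and §4.2 (eq. MT as the kernel of a map)] -/
theorem exists_top_character (hdvd : ∀ i, lev i ∣ lev i₀) (hodd : ∀ i, Odd (lev i₀ / lev i))
    (hrad : ∀ i (a : ℕ), a.Coprime (lev i) → a.Coprime (lev i₀)) (h2 : 2 < lev i₀)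
    (hΦ : ∀ i (σ : K i →+* ℂ), σ ∈ (Φ i).1 ↔ 2 * (expOf (lev i) (K i) σ).val < lev i)
    (f : ((i : Fin k) × (K i →+* ℂ)) → ℤ) :
    ∃ g : (K i₀ →+* ℂ) → ℤ, ∀ τ : ℂ ≃+* ℂ,
      ∑ z, (f z : ℚ) * translateInd (familyType Φ) τ z = ∑ x, (g x : ℚ) * translateInd (Φ i₀).1 τ x := by
  obtain ⟨M, hM⟩ := exists_int_matrix_translateInd_familyType hdvd hodd hrad h2 hΦ
  refine ⟨fun x => ∑ z, f z * M z x, fun τ => ?_⟩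
  simp only [hM, Finset.mul_sum]
  rw [Finset.sum_comm]
  push_cast
  simp only [Finset.sum_mul]
  refine Finset.sum_congr rfl fun x _ => Finset.sum_congr rfl fun z _ => ?_
  ring

/-- **Every vector of the rational span of the translates of `Σ` is determined by its top component, through the integer matrix.**
[cite: GalleseGoodsonLombardo2024, §7.2 (proof of the Proposition)] -/
theorem apply_eq_sum_top_of_mem_span (hdvd : ∀ i, lev i ∣ lev i₀) (hodd : ∀ i, Odd (lev i₀ / lev i))
    (hrad : ∀ i (a : ℕ), a.Coprime (lev i) → a.Coprime (lev i₀)) (h2 : 2 < lev i₀)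
    (hΦ : ∀ i (σ : K i →+* ℂ), σ ∈ (Φ i).1 ↔ 2 * (expOf (lev i) (K i) σ).val < lev i) :
    ∃ M : ((i : Fin k) × (K i →+* ℂ)) → (K i₀ →+* ℂ) → ℤ,
      ∀ f ∈ Submodule.span ℚ (Set.range fun τ : ℂ ≃+* ℂ => translateInd (familyType Φ) τ),
        ∀ z, f z = ∑ x, (M z x : ℚ) * f ⟨i₀, x⟩ := by
  obtain ⟨M, hM⟩ := exists_int_matrix_translateInd_familyType hdvd hodd hrad h2 hΦ
  refine ⟨M, fun f hf => ?_⟩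
  refine Submodule.span_induction (p := fun f _ => ∀ z, f z = ∑ x, (M z x : ℚ) * f ⟨i₀, x⟩) ?_ ?_ ?_ ?_ hf
  · rintro _ ⟨τ, rfl⟩ z
    dsimp only
    rw [hM τ z]
    refine Finset.sum_congr rfl fun x _ => ?_
    rw [CMAlgebra.translateInd_familyType]
  · intro z
    simp
  · intro f g _ _ hf hg z
    simp only [Pi.add_apply, hf z, hg z, ← Finset.sum_add_distrib, mul_add]
  · intro c f _ hf z
    simp only [Pi.smul_apply, smul_eq_mul, hf z, Finset.mul_sum]
    refine Finset.sum_congr rfl fun x _ => ?_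
    ring

/-- **THE PROPOSITION, SATURATED COCHARACTER FORM.**  A vector of the rational span of the translates of `Σ` (the rational
cocharacter space of `MT(∏_i A_i)`) is INTEGRAL as soon as its top component is: the projection maps the lattice of integral
points of `span_ℚ{v_τ}` — the cocharacter group `X_*(MT(J_{p^k}))` — ONTO that of `span_ℚ{w_τ}` = `X_*(MT(X_{p^k}))` with
integral inverse; together with `eq_zero_of_top_eq_zero` (injectivity) this is the isomorphism of the cocharacter LATTICES,
finer than the equality of their ranks (the isogeny). [cite: GalleseGoodsonLombardo2024, §1 «Results in families» Proposition and §7.2] -/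
theorem integral_of_top_integral (hdvd : ∀ i, lev i ∣ lev i₀) (hodd : ∀ i, Odd (lev i₀ / lev i))
    (hrad : ∀ i (a : ℕ), a.Coprime (lev i) → a.Coprime (lev i₀)) (h2 : 2 < lev i₀)
    (hΦ : ∀ i (σ : K i →+* ℂ), σ ∈ (Φ i).1 ↔ 2 * (expOf (lev i) (K i) σ).val < lev i)
    {f : ((i : Fin k) × (K i →+* ℂ)) → ℚ}
    (hf : f ∈ Submodule.span ℚ (Set.range fun τ : ℂ ≃+* ℂ => translateInd (familyType Φ) τ))
    (hint : ∀ x : K i₀ →+* ℂ, ∃ c : ℤ, f ⟨i₀, x⟩ = c) (z : (i : Fin k) × (K i →+* ℂ)) : ∃ c : ℤ, f z = c := by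
  classical
  obtain ⟨M, hM⟩ := apply_eq_sum_top_of_mem_span (Φ := Φ) hdvd hodd hrad h2 hΦ
  choose c hc using hint
  refine ⟨∑ x, M z x * c x, ?_⟩
  rw [hM f hf z]
  push_cast
  exact Finset.sum_congr rfl fun x _ => by rw [hc x]

/-- **Injectivity on the rational span**: a vector of `span_ℚ{v_τ}` with zero top component is zero — the projection
`X_*(MT(∏_i A_i)) ⊗ ℚ → X_*(MT(A_{top})) ⊗ ℚ` is injective, i.e. `MT(J_{p^k}) → MT(X_{p^k})` is an ISOGENY (equal ranks:
`cmFamilyRank_eq_cmTypeRank_of_isPrimePow`, Goodson's Conjectures 5.9/5.11 in rank form).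
[cite: GalleseGoodsonLombardo2024, §7.2 (proof of the Proposition)] [cite: Goodson2024DegeneracyFermat, §5.3 Conjectures 5.9, 5.11] -/
theorem eq_zero_of_top_eq_zero (hdvd : ∀ i, lev i ∣ lev i₀) (hodd : ∀ i, Odd (lev i₀ / lev i))
    (hrad : ∀ i (a : ℕ), a.Coprime (lev i) → a.Coprime (lev i₀)) (h2 : 2 < lev i₀)
    (hΦ : ∀ i (σ : K i →+* ℂ), σ ∈ (Φ i).1 ↔ 2 * (expOf (lev i) (K i) σ).val < lev i)
    {f : ((i : Fin k) × (K i →+* ℂ)) → ℚ}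
    (hf : f ∈ Submodule.span ℚ (Set.range fun τ : ℂ ≃+* ℂ => translateInd (familyType Φ) τ))
    (htop : ∀ x : K i₀ →+* ℂ, f ⟨i₀, x⟩ = 0) : f = 0 := by
  obtain ⟨M, hM⟩ := apply_eq_sum_top_of_mem_span (Φ := Φ) hdvd hodd hrad h2 hΦ
  funext z
  rw [hM f hf z]
  simp [htop]

open scoped Classical in
/-- **THEOREM 62 (1): the equations `f_a`.**  For a lower embedding `z = (d₁, y)` and ANY partition `B ⊔ C` of its fibre
`{x : e(x) ≡ e(y) (mod d₁)}` in `Hom(ℚ(ζ_{d₀}), ℂ)` with `|B| = (d₀/d₁ − 1)/2` (so `|C| = |B| + 1`), the integral character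
`δ_z + Σ_{b∈B} δ_{b̄} − Σ_{c∈C} δ_c` ANNIHILATES EVERY TRANSLATE of `Σ`: it is an EQUATION of the Mumford–Tate group of the family —
«for every integer `1 ≤ a ≤ m−1` divisible by `p` and any choice of sets `B, C` as above, the expression
`f_a : x_a · ∏_{b∈B} x_{p^k−b} / ∏_{c∈C} x_c` is an equation for `MT(J_m)`», proved there from Lemma 60 exactly as here
(`Σ_B (w(b) + w(b̄)) = |B|`).  [cite: GalleseGoodsonLombardo2024, §7.2 Thm. 62 (1) and eq. (additional f_a equation form)] -/
theorem equation_fa (hdvd : ∀ i, lev i ∣ lev i₀) (hodd : ∀ i, Odd (lev i₀ / lev i))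
    (hrad : ∀ i (a : ℕ), a.Coprime (lev i) → a.Coprime (lev i₀)) (h2 : 2 < lev i₀)
    (hΦ : ∀ i (σ : K i →+* ℂ), σ ∈ (Φ i).1 ↔ 2 * (expOf (lev i) (K i) σ).val < lev i)
    (z : (i : Fin k) × (K i →+* ℂ)) {B : Finset (K i₀ →+* ℂ)}
    (hB : B ⊆ Finset.univ.filter fun x : K i₀ →+* ℂ =>
      ZMod.castHom (hdvd z.1) (ZMod (lev z.1)) (expOf (lev i₀) (K i₀) x) = expOf (lev z.1) (K z.1) z.2)
    (hcard : 2 * B.card + 1 = lev i₀ / lev z.1) (τ : ℂ ≃+* ℂ) :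
    translateInd (familyType Φ) τ z + ∑ b ∈ B, translateInd (Φ i₀).1 τ (ComplexEmbedding.conjugate b) -
      ∑ c ∈ (Finset.univ.filter fun x : K i₀ →+* ℂ =>
          ZMod.castHom (hdvd z.1) (ZMod (lev z.1)) (expOf (lev i₀) (K i₀) x) = expOf (lev z.1) (K z.1) z.2) \ B,
        translateInd (Φ i₀).1 τ c = 0 := by
  obtain ⟨i, y⟩ := z
  dsimp only at hB hcard ⊢
  rw [translateInd_familyType_eq_sum_fibre_sub (hdvd i) (hodd i) (hrad i) hΦ τ y]
  simp only [CMAlgebra.translateInd_familyType, translateInd_conjugate_eq_one_sub h2]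
  rw [Finset.sum_sub_distrib, Finset.sum_const, ← Finset.sum_sdiff hB]
  simp only [nsmul_eq_mul, mul_one]
  have hc : ((lev i₀ / lev i - 1) / 2 : ℕ) = B.card := by omega
  rw [hc]
  ring

end Lattice

/-! ## §4 The printed case: the Jacobian family of an odd prime power `J_{p^k} ∼ X_p × X_{p²} × ⋯ × X_{p^k}` -/

section PrimePower

open Literature.NumberTheory.ComplexMultiplication
open Literature.AlgebraicGeometry.Motives (CMType)
open Literature.AlgebraicGeometry.Pohlmann1968 Literature.AlgebraicGeometry.Pohlmann1968.Cyclotomic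
open Literature.AlgebraicGeometry.Pohlmann1968.CMAlgebra
open scoped Literature.NumberTheory.ComplexMultiplication

variable {k : ℕ} {lev : Fin k → ℕ} [∀ i, NeZero (lev i)] {K : Fin k → Type} [∀ i, Field (K i)]
  [∀ i, NumberField (K i)] [∀ i, IsCyclotomicExtension {lev i} ℚ (K i)] {Φ : ∀ i, CMType (K i)} {i₀ : Fin k}

omit [∀ i, NeZero (lev i)] [∀ i, NumberField (K i)] [∀ i, IsCyclotomicExtension {lev i} ℚ (K i)] in
/-- **The levels of `J_{p^k}`.**  For levels `d_i > 1` dividing an odd prime power `m = p^k` with `d_{i₀} = m`: every `d_i = p^{j_i}`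
divides `d_{i₀}`, the quotients `p^{k−j_i}` are odd, and an integer prime to `d_i` is prime to `d_{i₀}` (same prime `p`) — the
standing hypotheses of §§2–3. [cite: GalleseGoodsonLombardo2024, §7.2 (proof of the Proposition: «`J_{p^k} ∼ ∏_{1 ≤ i ≤ k} X_{p^i}`»)] -/
theorem levels_of_isPrimePow {m : ℕ} (hodd : Odd m) (hpp : IsPrimePow m) (hdvd : ∀ i, lev i ∣ m) (hi₀ : lev i₀ = m)
    (h1 : ∀ i, 1 < lev i) :
    (∀ i, lev i ∣ lev i₀) ∧ (∀ i, Odd (lev i₀ / lev i)) ∧ (∀ i (a : ℕ), a.Coprime (lev i) → a.Coprime (lev i₀)) := by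
  obtain ⟨p, e, hp, he, rfl⟩ := (isPrimePow_nat_iff m).1 hpp
  have hpodd : Odd p := (Nat.odd_pow_iff he.ne').1 hodd
  have hlev : ∀ i, ∃ j, 0 < j ∧ j ≤ e ∧ lev i = p ^ j := fun i => by
    obtain ⟨j, hj, hji⟩ := (Nat.dvd_prime_pow hp).1 (hdvd i)
    refine ⟨j, Nat.pos_of_ne_zero ?_, hj, hji⟩
    rintro rfl
    have := h1 i
    rw [hji, pow_zero] at this
    omega
  refine ⟨fun i => by rw [hi₀]; exact hdvd i, fun i => ?_, fun i a ha => ?_⟩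
  · obtain ⟨j, _, hj, hji⟩ := hlev i
    rw [hi₀, hji, Nat.pow_div hj hp.pos]
    exact hpodd.pow
  · obtain ⟨j, hj0, _, hji⟩ := hlev i
    rw [hji] at ha
    rw [hi₀]
    exact (Nat.Coprime.coprime_dvd_right (dvd_pow_self p hj0.ne') ha).pow_right e

/-- **GALLESE–GOODSON–LOMBARDO'S PROPOSITION FOR `J_{p^k}`, CHARACTER FORM.**  «Let `p` be an odd prime number, `k` be a positive
integer, and let `X_{p^k}` be the largest simple factor of `J_{p^k}`. The projection `J_{p^k} → X_{p^k}` induces an isomorphism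
`MT(J_{p^k}) → MT(X_{p^k})` between the corresponding Mumford–Tate groups.»  On the CM data of `J_m`, `m = p^k` (lower-half types
`Φ_i` of `ℚ(ζ_{d_i})` at levels `1 < d_i ∣ m`, one of them `m`): every integral character `f` of `⊔_i Hom(ℚ(ζ_{d_i}), ℂ)` agrees on
ALL Galois translates of `Σ = ⊔_i Φ_i` with an integral character `g` of the top factor alone — `ℤ[E_top] + ker 𝔈 = ℤ[E]`,
Lombardo's criterion for the projection of Mumford–Tate groups to be an ISOMORPHISM (the rank equality = isogeny being
`cmFamilyRank_eq_cmTypeRank_of_isPrimePow`; contrast `m = 15`, where the projection «is an isogeny, not an isomorphism»).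
[cite: GalleseGoodsonLombardo2024, §1 «Results in families», Proposition (MTprojection); §7.2 (proof)]
[cite: Goodson2024DegeneracyFermat, §5.3 Props. 5.8, 5.10 and Conjectures 5.9, 5.11] -/
theorem exists_top_character_of_isPrimePow {m : ℕ} (hm : 2 < m) (hodd : Odd m) (hpp : IsPrimePow m)
    (hdvd : ∀ i, lev i ∣ m) (hi₀ : lev i₀ = m) (h1 : ∀ i, 1 < lev i)
    (hΦ : ∀ i (σ : K i →+* ℂ), σ ∈ (Φ i).1 ↔ 2 * (expOf (lev i) (K i) σ).val < lev i)
    (f : ((i : Fin k) × (K i →+* ℂ)) → ℤ) :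
    ∃ g : (K i₀ →+* ℂ) → ℤ, ∀ τ : ℂ ≃+* ℂ,
      ∑ z, (f z : ℚ) * translateInd (familyType Φ) τ z = ∑ x, (g x : ℚ) * translateInd (Φ i₀).1 τ x := by
  obtain ⟨hd, ho, hr⟩ := levels_of_isPrimePow (lev := lev) hodd hpp hdvd hi₀ h1
  exact exists_top_character hd ho hr (by omega) hΦ f

/-- **GALLESE–GOODSON–LOMBARDO'S PROPOSITION FOR `J_{p^k}`, COCHARACTER FORM.**  A rational combination of the Galois conjugates of
Deligne's cocharacter of `J_{p^k}` (a rational cocharacter of `MT(J_{p^k})`) is INTEGRAL iff its component on the top factor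
`X_{p^k}` is: the projection identifies the cocharacter LATTICES `X_*(MT(J_{p^k})) ≅ X_*(MT(X_{p^k}))`, not only their ranks.
[cite: GalleseGoodsonLombardo2024, §1 «Results in families», Proposition (MTprojection); §7.2 (proof)] -/
theorem integral_of_top_integral_of_isPrimePow {m : ℕ} (hm : 2 < m) (hodd : Odd m) (hpp : IsPrimePow m)
    (hdvd : ∀ i, lev i ∣ m) (hi₀ : lev i₀ = m) (h1 : ∀ i, 1 < lev i)
    (hΦ : ∀ i (σ : K i →+* ℂ), σ ∈ (Φ i).1 ↔ 2 * (expOf (lev i) (K i) σ).val < lev i)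
    {f : ((i : Fin k) × (K i →+* ℂ)) → ℚ}
    (hf : f ∈ Submodule.span ℚ (Set.range fun τ : ℂ ≃+* ℂ => translateInd (familyType Φ) τ))
    (hint : ∀ x : K i₀ →+* ℂ, ∃ c : ℤ, f ⟨i₀, x⟩ = c) (z : (i : Fin k) × (K i →+* ℂ)) : ∃ c : ℤ, f z = c := by
  obtain ⟨hd, ho, hr⟩ := levels_of_isPrimePow (lev := lev) hodd hpp hdvd hi₀ h1
  exact integral_of_top_integral hd ho hr (by omega) hΦ hf hint z

/-- **LEMMA 60 for `J_{p^k}` between ANY two of its levels `p^j ∣ p^k`**: `[τ∘y ∈ Φ_{p^j}] = #{x : e(x) ≡ e(y) (mod p^j), τ∘x ∈ Φ_{p^k}}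
− (p^{k−j} − 1)/2` (printed for `j = k − 1`; the fibre count needs only that all residues above a unit are units).
[cite: GalleseGoodsonLombardo2024, §7.2 Lemma 60] -/
theorem translateInd_familyType_eq_sum_fibre_sub_of_isPrimePow {m : ℕ} (hodd : Odd m) (hpp : IsPrimePow m)
    (hdvd : ∀ i, lev i ∣ m) (hi₀ : lev i₀ = m) (h1 : ∀ i, 1 < lev i)
    (hΦ : ∀ i (σ : K i →+* ℂ), σ ∈ (Φ i).1 ↔ 2 * (expOf (lev i) (K i) σ).val < lev i)
    (τ : ℂ ≃+* ℂ) (z : (i : Fin k) × (K i →+* ℂ)) :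
    translateInd (familyType Φ) τ z =
      (∑ x ∈ Finset.univ.filter fun x : K i₀ →+* ℂ =>
          ZMod.castHom ((levels_of_isPrimePow hodd hpp hdvd hi₀ h1).1 z.1) (ZMod (lev z.1)) (expOf (lev i₀) (K i₀) x) =
            expOf (lev z.1) (K z.1) z.2,
        translateInd (familyType Φ) τ ⟨i₀, x⟩) - ((lev i₀ / lev z.1 - 1) / 2 : ℕ) := by
  obtain ⟨hd, ho, hr⟩ := levels_of_isPrimePow (lev := lev) hodd hpp hdvd hi₀ h1
  obtain ⟨i, y⟩ := z
  exact translateInd_familyType_eq_sum_fibre_sub (hd i) (ho i) (hr i) hΦ τ y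

end PrimePower

end HyperellipticJacobian

end Literature.AlgebraicGeometry.ComplexMultiplication
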